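import Summits.ResolutionOfSingularities.ResolutionOfSingularities.Theorems.FrobeniusLadderFInjectiveMacaulayficationToricRingSplitting
import HarnessLib

/-!
# T-TOR IN-HOUSE, F-side engine (generic corollary): an INEQUALITY DESCRIPTION of the word-exponent monoid gives (SAT′), hence F-splitting, for ANY cone datum
# (crux `FInjectiveMacaulayfication` stmt-ResolutionOfSingularities-15315, chain w45a; res-L1-w45a-plan-1 R23.13 (2)/R23.26 «reusable F-side (normal toric charts
# FULL without regularity certificates)»; seat res-L1-w45a-lead-1 g13)

[OURS · L1 W4.5a] Support file (`--supports stmt-ResolutionOfSingularities-15315 --as helper`); def-free; UNCONDITIONAL; no named fact; NOT a statement of any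
manuscript. AI-written (AI review is weaker than expert review). Nothing of the crux is proved here.

For a cone datum `D : ConeDatum d r` whose word exponents are EXACTLY the lattice points of `ℕ^d` satisfying finitely many homogeneous linear inequalities
`Σ_s A i s · v s ≥ 0` (`hineq`: every word exponent satisfies them; `hgen`: every `v ∈ ℕ^d` satisfying them is a word exponent — the Hilbert-basis statement, to be
certified per bed, e.g. ✓`RMonoidSaturated.exists_word_of_ineq'` for `U_R`), the saturation hypothesis (SAT′) of ✓`ToricRingSplitting.exists_split_toricRing` holds
(`saturated_of_ineq`), so `Ring k P D` is F-split and every ideal of every localisation is Frobenius closed (`fClause_localization_of_ineq`), every field of char `p`.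
[folklore; cite: CoxLittleSchenck2011, §1.2 (context: saturated affine semigroups); HochsterRoberts1976 (context)]
-/

-- single-problem summit: the doubled namespace component is forced
set_option linter.dupNamespace false

noncomputable section

namespace Summit.ResolutionOfSingularities.ResolutionOfSingularities.Theorems.FInjectiveMacaulayfication.ToricSaturationOfInequalities

open Summit.ResolutionOfSingularities.ResolutionOfSingularities.Theorems.FInjectiveMacaulayfication
open Summit.ResolutionOfSingularities.ResolutionOfSingularities.Theorems.WildQuotientResolution.ToricChart

/-- ★ **(SAT′) from an inequality description.** If the word exponents of `D` are exactly the solutions in `ℕ^d` of the homogeneous integer inequalities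
`Σ_s A i s · v s ≥ 0` (`i < m`), then for every `n ≥ 1` a word exponent divisible by `n` coordinatewise is `n` times a word exponent. [OURS · L1 W4.5a] -/
theorem saturated_of_ineq {d r m : ℕ} (D : ConeDatum d r) (A : Fin m → Fin d → ℤ)
    (hineq : ∀ (w : Word d r) (i : Fin m), 0 ≤ ∑ s, A i s * (wordExp D w s : ℤ))
    (hgen : ∀ v : Fin d → ℕ, (∀ i : Fin m, 0 ≤ ∑ s, A i s * (v s : ℤ)) → ∃ w : Word d r, wordExp D w = v)
    (n : ℕ) (hn : 0 < n) (w : Word d r) (hdiv : ∀ s, n ∣ wordExp D w s) :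
    ∃ w' : Word d r, ∀ s, wordExp D w s = n * wordExp D w' s := by
  choose q hq using hdiv
  have hv : ∀ i : Fin m, 0 ≤ ∑ s, A i s * (q s : ℤ) := by
    intro i
    have h := hineq w i
    have hrw : (∑ s, A i s * (wordExp D w s : ℤ)) = (n : ℤ) * ∑ s, A i s * (q s : ℤ) := by
      rw [Finset.mul_sum]
      exact Finset.sum_congr rfl fun s _ => by rw [hq s]; push_cast; ring
    rw [hrw] at h
    exact nonneg_of_mul_nonneg_right h (by exact_mod_cast hn)
  obtain ⟨w', hw'⟩ := hgen q hv
  exact ⟨w', fun s => by rw [hw', hq s]⟩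

/-- ★ **F-clause at every localisation from an inequality description**: every ideal of every localisation of `Ring k P D` satisfies the crux's inline
Frobenius-closure clause, for every field `k` of characteristic `p`. [OURS · L1 W4.5a] -/
theorem fClause_localization_of_ineq (p : ℕ) [Fact p.Prime] (k : Type) [Field k] [CharP k p] (P : Type) {d r m : ℕ} (D : ConeDatum d r)
    (A : Fin m → Fin d → ℤ)
    (hineq : ∀ (w : Word d r) (i : Fin m), 0 ≤ ∑ s, A i s * (wordExp D w s : ℤ))
    (hgen : ∀ v : Fin d → ℕ, (∀ i : Fin m, 0 ≤ ∑ s, A i s * (v s : ℤ)) → ∃ w : Word d r, wordExp D w = v)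
    (S : Type) [CommRing S] [Algebra (Ring k P D) S] (M : Submonoid (Ring k P D)) [IsLocalization M S] (I : Ideal S) :
    ∀ y : S, (∃ e : ℕ, y ^ p ^ e ∈ Ideal.span ((fun z : S => z ^ p ^ e) '' (I : Set S))) → y ∈ I :=
  ToricRingSplitting.fClause_localization_toricRing p k P D
    (fun w hw => saturated_of_ineq D A hineq hgen p (Fact.out : p.Prime).pos w hw) S M I

end Summit.ResolutionOfSingularities.ResolutionOfSingularities.Theorems.FInjectiveMacaulayfication.ToricSaturationOfInequalities

end
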